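import Literature.Geometry.Kaehler.AnalyticSet
import Literature.NumberTheory.Transcendental.ProjectiveSpaceProofs
import Literature.NumberTheory.Transcendental.ProjectiveSpaceT2Proofs
import Mathlib.Analysis.Calculus.InverseFunctionTheorem.ContDiff
import Mathlib.Geometry.Manifold.ContMDiff.Atlas
import Mathlib.Geometry.Manifold.MFDeriv.Atlas
import HarnessLib

/-!
# Route `SecondaryPeriods` — crux `RiemannWeightOne` (stmt-HodgeConjecture-16406), line `birth`: stub `stub_imageAnalytic`

The registered stub `stub_imageAnalytic` of the line skeleton
`Summits/HodgeConjecture/HodgeConjecture/Cruxes/RiemannWeightOne/Lines/birth.lean`, proved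
unconditionally: **the image of a compact complex manifold under an injective holomorphic
immersion into `ℙᴺ(ℂ)` is an analytic subset of `ℙᴺ(ℂ)`.**

**Proof** (Chirka, *Complex Analytic Sets*, §2.1–2.3; Griffiths–Harris, Ch. 0 §2;
Fritzsche–Grauert, Ch. IV §1). The general local statement is
`isAnalyticSetAt_range_of_isEmbedding`: if `F : M → P` is a holomorphic map of complex manifolds
(models `E`, `E'` finite-dimensional, trivial model with corners) which is a topological embedding and
whose differential at `x₀` is injective, then `range F` is analytic at `F x₀`. In the extended
charts `φ` at `x₀` and `χ` at `F x₀` the map reads `f = χ ∘ F ∘ φ⁻¹`, `C^ω` near `a = φ x₀` with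
injective derivative `A = df_a`. Choosing a complement `K` of `range A`
(`exists_continuousLinearEquiv_prod_of_injective`), the map `G (u, k) = f u + k : E × K → E'` has
invertible derivative `(u, k) ↦ A u + k` at `(a, 0)`, so the `C^ω` inverse function theorem
(`ContDiffAt.toOpenPartialHomeomorph`, `ContDiffAt.to_localInverse`) makes it a local biholomorphism
`e₀`. Since `F` is an embedding, a small coordinate neighbourhood `V` of `x₀` has `F(V) = range F ∩ W'`
for an open `W'`; on a suitable open `W ∋ F x₀` the holomorphic map
`g = ψ ∘ pr₂ ∘ e₀⁻¹ ∘ χ` (`ψ : K ≅ ℂᵐ`) cuts out `range F`: points `F x`, `x ∈ V`, satisfy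
`χ (F x) = f (φ x) = G (φ x, 0)`, so `g = 0`; conversely `g y = 0` gives `χ y = G (u, 0) = f u =
χ (F (φ⁻¹ u))`, hence `y = F (φ⁻¹ u)` by injectivity of `χ` on its source. Globally
(`stub_imageAnalytic`): `F` is a closed embedding (continuous injection, compact source, Hausdorff
target), `range F` is closed, and `isAnalyticSet_iff_isClosed_and` reduces to the points of the image.

## References

* [Chirka1989] E. M. Chirka, *Complex Analytic Sets*, Kluwer (1989), §2.1–2.3.
* [GriffithsHarris1978] P. Griffiths, J. Harris, *Principles of Algebraic Geometry* (1978), Ch. 0 §1–2.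
* [FritzscheGrauert2002] K. Fritzsche, H. Grauert, *From Holomorphic Functions to Complex
  Manifolds*, GTM 213 (2002), Ch. IV §1.
* [LeeSmoothManifolds2013] J. M. Lee, *Introduction to Smooth Manifolds*, 2nd ed. (2013), Thm. 4.12,
  Prop. 5.22 (local embedding theorem; the real model of the argument).
-/

noncomputable section

-- every declaration of this problem lives in `Summit.HodgeConjecture.HodgeConjecture.…`
set_option linter.dupNamespace false

namespace Summit.HodgeConjecture.HodgeConjecture.Theorems.RiemannWeightOne

open scoped Manifold ContDiff LinearAlgebra.Projectivization Topology
open Literature.Geometry.Kaehler (IsAnalyticSet IsAnalyticSetAt)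
open Set Function Module

section Local

variable {E : Type*} [NormedAddCommGroup E] [NormedSpace ℂ E] [FiniteDimensional ℂ E]
  {E' : Type*} [NormedAddCommGroup E'] [NormedSpace ℂ E'] [FiniteDimensional ℂ E']

/-- **Linear algebra of the immersion normal form.** For an injective continuous linear map
`A : E → E'` of finite-dimensional complex vector spaces and a complement `K` of its range,
`(u, k) ↦ A u + k` is a continuous linear isomorphism `E × K ≅ E'`, and `dim K = dim E' - dim E`.
[folklore] -/
theorem exists_continuousLinearEquiv_prod_of_injective (A : E →L[ℂ] E') (hA : Injective A) :
    ∃ (K : Submodule ℂ E') (L : (E × K) ≃L[ℂ] E'),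
      (∀ p : E × K, L p = A p.1 + (p.2 : E')) ∧
      finrank ℂ K = finrank ℂ E' - finrank ℂ E := by
  -- adapted from `Literature.Topology.FourManifolds.exists_continuousLinearEquiv_prod_of_injective`
  -- (`Literature/Topology/FourManifolds/ImmersionCriterion.lean`, over `ℝ`)
  obtain ⟨K, hK⟩ := Submodule.exists_isCompl (LinearMap.range (A : E →ₗ[ℂ] E'))
  have hA' : Injective (A : E →ₗ[ℂ] E') := hA
  set L₁ : E ≃ₗ[ℂ] LinearMap.range (A : E →ₗ[ℂ] E') := LinearEquiv.ofInjective _ hA'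
  set L₂ : (E × K) ≃ₗ[ℂ] (LinearMap.range (A : E →ₗ[ℂ] E') × K) :=
    L₁.prodCongr (LinearEquiv.refl ℂ K)
  set L₃ : (LinearMap.range (A : E →ₗ[ℂ] E') × K) ≃ₗ[ℂ] E' :=
    Submodule.prodEquivOfIsCompl _ _ hK
  set L : (E × K) ≃ₗ[ℂ] E' := L₂.trans L₃ with hL
  refine ⟨K, L.toContinuousLinearEquiv, fun p => ?_, ?_⟩
  · change L p = A p.1 + (p.2 : E')
    simp only [hL, LinearEquiv.trans_apply]
    change Submodule.prodEquivOfIsCompl _ _ hK (L₁ p.1, p.2) = _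
    rw [Submodule.coe_prodEquivOfIsCompl']
    rfl
  · have h1 : finrank ℂ (LinearMap.range (A : E →ₗ[ℂ] E')) + finrank ℂ K = finrank ℂ E' :=
      Submodule.finrank_add_eq_of_isCompl hK
    have h2 : finrank ℂ (LinearMap.range (A : E →ₗ[ℂ] E')) = finrank ℂ E :=
      LinearMap.finrank_range_of_inj hA'
    omega

variable {M : Type*} [TopologicalSpace M] [ChartedSpace E M] [IsManifold 𝓘(ℂ, E) ω M]
  {P : Type*} [TopologicalSpace P] [ChartedSpace E' P] [IsManifold 𝓘(ℂ, E') ω P]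

/-- **The image of a holomorphic embedding is analytic at the image of an immersive point.**
Let `F : M → P` be a holomorphic (`C^ω`) map of complex manifolds (finite-dimensional models,
trivial model with corners) which is a topological embedding, and let `x₀ ∈ M` be a point where the
differential `mfderiv F x₀` is injective. Then `range F` is analytic at `F x₀`: in charts,
`G (u, k) = f u + k` (`f` the chart expression of `F`, `k` in a complement of the range of `df`) is
a local biholomorphism by the holomorphic inverse function theorem, and on a small open `W ∋ F x₀`
the image is the zero set of the `K`-component of `G⁻¹ ∘ χ`.
[cite: Chirka1989, §2.3] -/
theorem isAnalyticSetAt_range_of_isEmbedding {F : M → P} (hF : ContMDiff 𝓘(ℂ, E) 𝓘(ℂ, E') ω F)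
    (hemb : Topology.IsEmbedding F) (x₀ : M)
    (hdF : Injective (mfderiv 𝓘(ℂ, E) 𝓘(ℂ, E') F x₀)) :
    IsAnalyticSetAt 𝓘(ℂ, E') (range F) (F x₀) := by
  haveI : CompleteSpace E := FiniteDimensional.complete ℂ E
  -- charts and the chart expression `f = χ ∘ F ∘ φ⁻¹`
  set φ := extChartAt 𝓘(ℂ, E) x₀ with hφ
  set χ := extChartAt 𝓘(ℂ, E') (F x₀) with hχ
  set f : E → E' := χ ∘ F ∘ φ.symm with hf_def
  set a : E := φ x₀ with ha
  -- `f` is `C^ω` on the open set `T ∋ a`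
  set T : Set E := φ.target ∩ φ.symm ⁻¹' (F ⁻¹' χ.source) with hT
  have hfT : ContDiffOn ℂ ω f T := (contMDiff_iff.1 hF).2 x₀ (F x₀)
  have hTo : IsOpen T :=
    (continuousOn_extChartAt_symm x₀).isOpen_inter_preimage (isOpen_extChartAt_target x₀)
      ((isOpen_extChartAt_source (F x₀)).preimage hF.continuous)
  have haT : a ∈ T := by
    refine ⟨mem_extChartAt_target x₀, ?_⟩
    show F (φ.symm (φ x₀)) ∈ χ.source
    rw [extChartAt_to_inv]
    exact mem_extChartAt_source (F x₀)
  have hfa_eq : f a = χ (F x₀) := by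
    show χ (F (φ.symm (φ x₀))) = χ (F x₀)
    rw [extChartAt_to_inv]
  -- the derivative of `f` at `a` is the (injective) differential `A`
  have hω : (ω : WithTop ℕ∞) ≠ 0 := by simp
  have hmd : MDifferentiableAt 𝓘(ℂ, E) 𝓘(ℂ, E') F x₀ := hF.mdifferentiableAt hω
  set A : E →L[ℂ] E' := mfderiv 𝓘(ℂ, E) 𝓘(ℂ, E') F x₀ with hA
  have hfa : HasFDerivAt f A a := by
    have hd : DifferentiableAt ℂ f a :=
      (hfT.differentiableOn hω a haT).differentiableAt (hTo.mem_nhds haT)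
    have h1 : fderiv ℂ f a = A := by
      rw [hA, hmd.mfderiv, ModelWithCorners.range_eq_univ, fderivWithin_univ]
      rfl
    rw [← h1]
    exact hd.hasFDerivAt
  -- a complement `K` of `range A` and the isomorphism `L (u, k) = A u + k`
  obtain ⟨K, L, hL, -⟩ := exists_continuousLinearEquiv_prod_of_injective A hdF
  haveI : CompleteSpace (E × K) := FiniteDimensional.complete ℂ (E × K)
  -- the map `G (u, k) = f u + k` and the inverse function theorem at `(a, 0)`
  set G : E × K → E' := fun q => f q.1 + (q.2 : E') with hG_def
  have hfa_cd : ContDiffAt ℂ ω f a := hfT.contDiffAt (hTo.mem_nhds haT)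
  have hGcd : ContDiffAt ℂ ω G (a, 0) := by
    have h1 : ContDiffAt ℂ ω (f ∘ Prod.fst) ((a, (0 : K)) : E × K) :=
      ContDiffAt.comp ((a, (0 : K)) : E × K) (by exact hfa_cd) contDiffAt_fst
    have h2 : ContDiffAt ℂ ω ((Submodule.subtypeL K : K → E') ∘ Prod.snd) ((a, (0 : K)) : E × K) :=
      ((Submodule.subtypeL K).contDiff.comp contDiff_snd).contDiffAt
    exact h1.add h2
  have hGd : HasFDerivAt G (L : E × K →L[ℂ] E') (a, 0) := by
    have h1 : HasFDerivAt (f ∘ Prod.fst) (A.comp (ContinuousLinearMap.fst ℂ E K))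
        ((a, (0 : K)) : E × K) :=
      HasFDerivAt.comp ((a, (0 : K)) : E × K) (by exact hfa) hasFDerivAt_fst
    have h2 : HasFDerivAt ((Submodule.subtypeL K : K → E') ∘ Prod.snd)
        ((Submodule.subtypeL K).comp (ContinuousLinearMap.snd ℂ E K)) ((a, (0 : K)) : E × K) :=
      HasFDerivAt.comp ((a, (0 : K)) : E × K) (Submodule.subtypeL K).hasFDerivAt hasFDerivAt_snd
    have hLeq : (L : E × K →L[ℂ] E') =
        A.comp (ContinuousLinearMap.fst ℂ E K) +
          (Submodule.subtypeL K).comp (ContinuousLinearMap.snd ℂ E K) := by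
      refine ContinuousLinearMap.ext fun q => ?_
      rw [ContinuousLinearEquiv.coe_coe, hL q]
      rfl
    rw [hLeq]
    exact h1.add h2
  set e₀ := hGcd.toOpenPartialHomeomorph G hGd hω with he₀
  have he₀_coe : (e₀ : E × K → E') = G := rfl
  have ha₀ : ((a, (0 : K)) : E × K) ∈ e₀.source := hGcd.mem_toOpenPartialHomeomorph_source hGd hω
  have hGa : G (a, 0) = f a := by simp [hG_def]
  have he₀a : e₀ (a, 0) = f a := by rw [he₀_coe, hGa]
  have hfa_t : f a ∈ e₀.target := he₀a ▸ e₀.map_source ha₀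
  have hsymm_a : e₀.symm (f a) = (a, 0) := by rw [← he₀a]; exact e₀.left_inv ha₀
  -- the inverse is differentiable on an open neighbourhood `T₁` of `f a`
  obtain ⟨T₁, hT₁o, haT₁, hT₁d⟩ : ∃ T₁ : Set E', IsOpen T₁ ∧ f a ∈ T₁ ∧
      ∀ w ∈ T₁, DifferentiableAt ℂ e₀.symm w := by
    have h := hGcd.to_localInverse hGd hω
    have h' : ∀ᶠ w in 𝓝 (G (a, 0)), ContDiffAt ℂ ω (hGcd.localInverse hGd hω) w :=
      h.eventually (by simp)
    obtain ⟨T₁, hT₁sub, hT₁o, hmem⟩ := mem_nhds_iff.1 h'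
    refine ⟨T₁, hT₁o, hGa ▸ hmem, fun w hw => ?_⟩
    have hw' : ContDiffAt ℂ ω (hGcd.localInverse hGd hω) w := hT₁sub hw
    exact hw'.differentiableAt hω
  -- `B`: a neighbourhood of `a` inside `T` whose zero section lies in `e₀.source`
  set B : Set E := T ∩ (fun u : E => ((u, (0 : K)) : E × K)) ⁻¹' e₀.source with hB
  have hBo : IsOpen B :=
    hTo.inter ((continuous_id.prodMk continuous_const).isOpen_preimage _ e₀.open_source)
  have haB : a ∈ B := ⟨haT, ha₀⟩
  -- `V`: the corresponding neighbourhood of `x₀`, and an open `W'` of `P` with `F ⁻¹' W' = V`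
  set V : Set M := φ.source ∩ φ ⁻¹' B with hV
  have hVo : IsOpen V := isOpen_extChartAt_preimage' x₀ hBo
  have hx₀V : x₀ ∈ V := ⟨mem_extChartAt_source x₀, haB⟩
  obtain ⟨W', hW'o, hW'V⟩ := hemb.isInducing.isOpen_iff.1 hVo
  -- the open set `W ∋ F x₀`
  set O : Set E' := T₁ ∩ (e₀.target ∩ e₀.symm ⁻¹' (B ×ˢ univ)) with hO
  have hOo : IsOpen O := hT₁o.inter (e₀.isOpen_inter_preimage_symm (hBo.prod isOpen_univ))
  set W : Set P := W' ∩ (χ.source ∩ χ ⁻¹' O) with hW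
  have hWo : IsOpen W := hW'o.inter (isOpen_extChartAt_preimage' (F x₀) hOo)
  have hx₀W : F x₀ ∈ W := by
    refine ⟨?_, mem_extChartAt_source (F x₀), ?_⟩
    · show x₀ ∈ F ⁻¹' W'
      rw [hW'V]
      exact hx₀V
    · show χ (F x₀) ∈ O
      rw [← hfa_eq]
      refine ⟨haT₁, hfa_t, ?_⟩
      show e₀.symm (f a) ∈ B ×ˢ univ
      rw [hsymm_a]
      exact ⟨haB, mem_univ _⟩
  -- the defining functions `g = ψ ∘ pr₂ ∘ e₀⁻¹ ∘ χ`
  set m : ℕ := finrank ℂ K with hm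
  have hKm : finrank ℂ K = finrank ℂ (Fin m → ℂ) := by rw [finrank_fin_fun]
  set ψ : K ≃L[ℂ] (Fin m → ℂ) := ContinuousLinearEquiv.ofFinrankEq hKm with hψ
  set g : P → (Fin m → ℂ) := fun y => ψ (e₀.symm (χ y)).2 with hg_def
  refine ⟨W, hWo, hx₀W, m, g, ?_, ?_⟩
  · -- holomorphy of `g` on `W`
    intro y hy
    have hyχ : y ∈ (chartAt E' (F x₀)).source := by
      rw [← extChartAt_source 𝓘(ℂ, E')]
      exact hy.2.1
    have h1 : MDifferentiableAt 𝓘(ℂ, E') 𝓘(ℂ, E') χ y := mdifferentiableAt_extChartAt hyχ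
    have h2 : DifferentiableAt ℂ (fun z : E' => ψ (e₀.symm z).2) (χ y) :=
      (ψ : K →L[ℂ] (Fin m → ℂ)).differentiableAt.comp (χ y) (hT₁d (χ y) hy.2.2.1).snd
    have h3 : MDifferentiableAt 𝓘(ℂ, E') 𝓘(ℂ, Fin m → ℂ) (fun z : E' => ψ (e₀.symm z).2) (χ y) :=
      mdifferentiableAt_iff_differentiableAt.2 h2
    exact (h3.comp y h1).mdifferentiableWithinAt
  · -- `range F ∩ W = W ∩ g ⁻¹' {0}`
    refine Set.ext fun y => ⟨?_, ?_⟩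
    · rintro ⟨hyF, hyW⟩
      refine ⟨hyW, ?_⟩
      obtain ⟨x, rfl⟩ := hyF
      have hxV : x ∈ V := by
        rw [← hW'V]
        exact hyW.1
      have hfu : f (φ x) = χ (F x) := by
        show χ (F (φ.symm (φ x))) = χ (F x)
        rw [φ.left_inv hxV.1]
      have hGu : e₀ (φ x, 0) = χ (F x) := by
        rw [he₀_coe, ← hfu]
        simp [hG_def]
      have hx0 : ((φ x, (0 : K)) : E × K) ∈ e₀.source := hxV.2.2
      show g (F x) = 0
      simp only [hg_def]
      rw [← hGu, e₀.left_inv hx0]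
      simp
    · rintro ⟨hyW, hgy⟩
      refine ⟨?_, hyW⟩
      obtain ⟨-, hyt, hyB⟩ := hyW.2.2
      have hgy' : g y = 0 := hgy
      have hq2 : (e₀.symm (χ y)).2 = 0 := by
        have h : ψ (e₀.symm (χ y)).2 = 0 := hgy'
        exact (map_eq_zero_iff ψ ψ.injective).1 h
      have hq1 : (e₀.symm (χ y)).1 ∈ B := hyB.1
      have hGq : G (e₀.symm (χ y)) = χ y := by
        rw [← he₀_coe]
        exact e₀.right_inv hyt
      have hfq : f (e₀.symm (χ y)).1 = χ y := by
        have h : G (e₀.symm (χ y)) = f (e₀.symm (χ y)).1 := by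
          simp only [hG_def, hq2, ZeroMemClass.coe_zero, add_zero]
        rw [← h, hGq]
      refine ⟨φ.symm (e₀.symm (χ y)).1, ?_⟩
      have h2 : F (φ.symm (e₀.symm (χ y)).1) ∈ χ.source := hq1.1.2
      exact χ.injOn h2 hyW.2.1 hfq

end Local

/-- **stub_imageAnalytic** (the registered stub of the line `birth`, verbatim). The image of a
compact complex manifold `M` (model `ℂⁿ`) under an injective holomorphic immersion
`F : M → ℙᴺ(ℂ)` is an analytic subset of `ℙᴺ(ℂ)`: `F` is a closed embedding (continuous injection
from a compact space to the Hausdorff space `ℙᴺ(ℂ)`, `t2Space_projectivization_holds`), so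
`range F` is closed, and at each point `F x₀` the holomorphic inverse function theorem straightens
the immersion (`isAnalyticSetAt_range_of_isEmbedding`, on the complex manifold `ℙᴺ(ℂ)`,
`isManifold_projectivization_holds`); conclude by `isAnalyticSet_iff_isClosed_and`.
[cite: Chirka1989, §2.3] -/
theorem stub_imageAnalytic :
    ∀ ⦃n N : ℕ⦄ ⦃M : Type⦄ [TopologicalSpace M] [T2Space M] [CompactSpace M]
      [ChartedSpace (Fin n → ℂ) M] [IsManifold 𝓘(ℂ, Fin n → ℂ) ω M]
      (F : M → ℙ ℂ (Fin (N + 1) → ℂ)),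
      ContMDiff 𝓘(ℂ, Fin n → ℂ) 𝓘(ℂ, Fin N → ℂ) ω F → Function.Injective F →
      (∀ x, Function.Injective (mfderiv 𝓘(ℂ, Fin n → ℂ) 𝓘(ℂ, Fin N → ℂ) F x)) →
      IsAnalyticSet 𝓘(ℂ, Fin N → ℂ) (Set.range F) := by
  intro n N M _ _ _ _ _ F hF hFinj hFimm
  haveI : IsManifold 𝓘(ℂ, Fin N → ℂ) ω (ℙ ℂ (Fin (N + 1) → ℂ)) :=
    Literature.NumberTheory.Transcendental.isManifold_projectivization_holds ℂ N
  haveI : T2Space (ℙ ℂ (Fin (N + 1) → ℂ)) :=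
    Literature.NumberTheory.Transcendental.t2Space_projectivization_holds ℂ N
  have hemb : Topology.IsClosedEmbedding F := hF.continuous.isClosedEmbedding hFinj
  rw [Literature.Geometry.Kaehler.isAnalyticSet_iff_isClosed_and]
  refine ⟨hemb.isClosed_range, ?_⟩
  rintro _ ⟨x₀, rfl⟩
  exact isAnalyticSetAt_range_of_isEmbedding hF hemb.isEmbedding x₀ (hFimm x₀)

end Summit.HodgeConjecture.HodgeConjecture.Theorems.RiemannWeightOne

end
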